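import Literature.NumberTheory.Automorphic.ResGLnConeDictionaryCone
import Summits.Langlands.Langlands.Theorems.IrreducibilityBySelfDualityHeckeEigenvalueFieldStubDictW1
import Summits.Langlands.Langlands.Theorems.IrreducibilityBySelfDualityHeckeEigenvalueFieldStubDictW2
import Summits.Langlands.Langlands.Theorems.IrreducibilityBySelfDualityHeckeEigenvalueFieldStubDictW3
import Summits.Langlands.Langlands.Theorems.IrreducibilityBySelfDualityHeckeEigenvalueFieldStubDictW6
import Summits.Langlands.Langlands.Theorems.IrreducibilityBySelfDualityHeckeEigenvalueFieldStubDictW7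
import Summits.Langlands.Langlands.Theorems.IrreducibilityBySelfDualityHeckeEigenvalueFieldStubConeModel
import HarnessLib

/-!
# Crux `HeckeEigenvalueField` (stmt-Langlands-13632), line `Sketch` — the ANALYTIC half of the
# Borel–Wallach dictionary: the cone form of a `(𝔤, K_∞)`-cocycle is smooth and CLOSED

Namespace `Summit.Langlands.Langlands.Theorems.HeckeEigenvalueField.Res`.  Theorems only; `--supports`
helpers for the registered composition stub `stub_coneEigenfamily_clean` of `Lines/Sketch.lean`.

For `π = W / W'` automorphic on `GL_n(𝔸_K)`, the coefficients `E = E_λ(ℂ) ⊗ ε_S`, a cochain `η` of the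
`(𝔤, K_∞)`-complex `ConeDictionary.gkComplexLS π S λ` in degree `q + 1` and a finite-adelic `c`
(vocabulary of `Literature/…/ResGLnConeDictionary{,Cone}`):

* `contDiffAt_leftForm` — the left form `m ↦ (Y ↦ E(m) η(Y)(m, c))` is smooth at every invertible
  matrix (form-valued smoothness is tested on vectors, `stub_contDiffOn_continuousAlternatingMap_of_apply`,
  W1; on vectors it is the twisted evaluation of a fixed tensor, `stub_fderiv_twistedEval`, W7);
* `fderiv_leftForm_apply` — its flat derivative along `m₀ X` is the twisted evaluation of the Leibniz
  action of `X` on the value (W7, evaluation commutes with `fderiv`);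
* `extDeriv_leftTrivForm_eq_zero` — **`dω̃ = 0` on the invertible matrices for a COCYCLE `η`**: the
  Maurer–Cartan identity (`stub_extDeriv_leftTrivialised`, W2) + the two identifications above + the
  closed Chevalley–Eilenberg formula (`stub_ce_d_succ_apply_eq_sum`, W6) give
  `dω̃(m₀)(m₀X₀, …) = E(m₀) · (dη)(X₀, …)(m₀, c) = 0`;
* `differentiableAt_coneForm`, `extDeriv_coneForm_eq_zero` — **on the positive cone the cone form is
  differentiable and CLOSED**: near `H₀ = g₀g₀ᴴ` it is the pullback of `ω̃` along a smooth local section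
  `s` of the hermitian square (`stub_hermSquare_localSection`, W3; the pullback identity
  `ConeDictionary.coneForm_apply_tangent` on both right inverses `ds(H)` and `halfRight (s H)` of
  `dp_{s H}`), so `dω = s^*(dω̃) = 0` (`extDeriv_pullback`).

[cite: BorelWallach2000, VII 2.2–2.5] [cite: Borel1983Regularization, §3] [cite: Dupont1976, §1–2]
-/

set_option linter.dupNamespace false -- project-wide: `Summit.Langlands.Langlands` is the mandated namespace

noncomputable section

open scoped Matrix.Norms.Operator ContDiff Topology TensorProduct Classical Matrix
open Filter NumberField NumberField.mixedEmbedding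
open Literature.NumberTheory.Automorphic Literature.NumberTheory.Automorphic.RealMatrixGroup
  Literature.NumberTheory.Automorphic.ConeDictionary

-- Mathlib idiom (as in `GKModules`): commutator bracket on `Module.End` / matrix algebras
attribute [local instance 100] LieRing.ofAssociativeRing

-- Calculus of FORM-valued maps on `M_n(K_∞)` needs ONE topology on the matrices: the one of the
-- operator norm `Matrix.Norms.Operator` (a normed ring, as the Maurer–Cartan identity requires).  The
-- product-topology instances are removed in this file (the two topologies are equal, and definitionally
-- so at default transparency — `leftFormN` below is `leftForm` re-typed by `id`).
attribute [-instance] instTopologicalSpaceMatrix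
attribute [-instance] Matrix.instUniformSpace
-- so that derived normed structures on `hermSpace n K →L[ℝ] _` are found along the SAME path as the
-- `NormedAddCommGroup` instance of `hermSpace` (and not via `Submodule.seminormedAddCommGroup` and the
-- operator norm): the projection is tried first
attribute [local instance high] NormedAddCommGroup.toSeminormedAddCommGroup

namespace Summit.Langlands.Langlands.Theorems.HeckeEigenvalueField.Res

variable {n : ℕ} {K : Type} [Field K] [NumberField K] {hcpt : isCompact_glFiniteIntegralLevel n K}
  (π : AutomorphicRepData (AutomorphyDatum.gl n K hcpt))
  (S : Finset {w : InfinitePlace K // w.IsReal}) (lam : (K →+* ℂ) → Fin n → ℤ) {q : ℕ}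

/-! ### The left form and the left-trivialised form, typed over the operator-norm topology -/

/-- The left form `ConeDictionary.leftForm`, re-typed over the operator-norm topology of `M_n(K_∞)`
(by `id`: the same function). [folklore] -/
abbrev leftFormN (η : ConeDictionary.Cochain π lam (q + 1)) (c : BigHeckeGLn.FiniteAdelicGL n K) :
    Matrix (Fin n) (Fin n) (mixedSpace K) →
      Matrix (Fin n) (Fin n) (mixedSpace K) [⋀^Fin (q + 1)]→L[ℝ] ResGLnCohomology.CoeffModule ℂ n K lam :=
  fun m => @id (Matrix (Fin n) (Fin n) (mixedSpace K) [⋀^Fin (q + 1)]→L[ℝ] ResGLnCohomology.CoeffModule ℂ n K lam)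
    (leftForm π S lam η c m)

/-- The left-trivialised form `ConeDictionary.leftTrivForm`, re-typed over the operator-norm topology.
[folklore] -/
abbrev leftTrivFormN (η : ConeDictionary.Cochain π lam (q + 1)) (c : BigHeckeGLn.FiniteAdelicGL n K) :
    Matrix (Fin n) (Fin n) (mixedSpace K) →
      Matrix (Fin n) (Fin n) (mixedSpace K) [⋀^Fin (q + 1)]→L[ℝ] ResGLnCohomology.CoeffModule ℂ n K lam :=
  fun m => (leftFormN π S lam η c m).compContinuousLinearMap
    (ContinuousLinearMap.mul ℝ (Matrix (Fin n) (Fin n) (mixedSpace K)) (Ring.inverse m))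

/-- `leftTrivFormN` IS `leftTrivForm` (values). [folklore] -/
theorem leftTrivFormN_apply (η : ConeDictionary.Cochain π lam (q + 1)) (c : BigHeckeGLn.FiniteAdelicGL n K)
    (m : Matrix (Fin n) (Fin n) (mixedSpace K)) (Y : Fin (q + 1) → Matrix (Fin n) (Fin n) (mixedSpace K)) :
    leftTrivFormN π S lam η c m Y = leftTrivForm π S lam η c m Y :=
  rfl

/-! ### The left form is smooth at the invertible matrices -/

/-- **The left form, evaluated on fixed vectors, is the twisted evaluation of a fixed tensor**
(definitional). [folklore] -/
theorem leftForm_apply_eq (η : ConeDictionary.Cochain π lam (q + 1)) (c : BigHeckeGLn.FiniteAdelicGL n K)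
    (Y : Fin (q + 1) → Matrix (Fin n) (Fin n) (mixedSpace K)) :
    (fun m : Matrix (Fin n) (Fin n) (mixedSpace K) => leftForm π S lam η c m Y) =
      fun m => σS hcpt S lam (GLn.archOfMatrix n K m)
        (π.evalTensor (ResGLnCohomology.CoeffModule ℂ n K lam)
          (@id (π.W ⊗[ℂ] ResGLnCohomology.CoeffModule ℂ n K lam) (η fun i => toLie n K hcpt (Y i)))
          (adelicPt hcpt (GLn.archOfMatrix n K m) c)) :=
  rfl

/-- **The left form `m ↦ (Y ↦ E(m) η(Y)(m, c))` is smooth at every invertible matrix.**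
[cite: BorelWallach2000, VII 2.2] -/
theorem contDiffAt_leftForm (η : ConeDictionary.Cochain π lam (q + 1)) (c : BigHeckeGLn.FiniteAdelicGL n K)
    {m₀ : Matrix (Fin n) (Fin n) (mixedSpace K)} (hm₀ : IsUnit m₀) :
    ContDiffAt ℝ ∞ (leftFormN π S lam η c) m₀ := by
  have hopen : IsOpen {m : Matrix (Fin n) (Fin n) (mixedSpace K) | IsUnit m} := Units.isOpen
  have hon : ContDiffOn ℝ ∞ (leftFormN π S lam η c) {m | IsUnit m} := by
    refine stub_contDiffOn_continuousAlternatingMap_of_apply (leftFormN π S lam η c) fun Y => ?_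
    intro m hm
    exact (stub_fderiv_twistedEval hcpt π S lam
      (@id (π.W ⊗[ℂ] ResGLnCohomology.CoeffModule ℂ n K lam) (η fun i => toLie n K hcpt (Y i))) c hm).1.contDiffWithinAt
  exact hon.contDiffAt (hopen.mem_nhds hm₀)

/-- The left form is differentiable at every invertible matrix. [folklore] -/
theorem differentiableAt_leftForm (η : ConeDictionary.Cochain π lam (q + 1)) (c : BigHeckeGLn.FiniteAdelicGL n K)
    {m₀ : Matrix (Fin n) (Fin n) (mixedSpace K)} (hm₀ : IsUnit m₀) :
    DifferentiableAt ℝ (leftFormN π S lam η c) m₀ :=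
  (contDiffAt_leftForm π S lam η c hm₀).differentiableAt (by simp)

/-- **The flat derivative of the left form along `m₀ X`, on fixed vectors, is the twisted evaluation
of the Leibniz action of `X` on the value `η(Y)`.** [cite: BorelWallach2000, VII 2.2] -/
theorem fderiv_leftForm_apply (η : ConeDictionary.Cochain π lam (q + 1)) (c : BigHeckeGLn.FiniteAdelicGL n K)
    {m₀ : Matrix (Fin n) (Fin n) (mixedSpace K)} (hm₀ : IsUnit m₀) (Xm : Matrix (Fin n) (Fin n) (mixedSpace K))
    (Y : Fin (q + 1) → Matrix (Fin n) (Fin n) (mixedSpace K)) :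
    fderiv ℝ (leftFormN π S lam η c) m₀ (m₀ * Xm) Y =
      σS hcpt S lam (GLn.archOfMatrix n K m₀)
        (π.evalTensor (ResGLnCohomology.CoeffModule ℂ n K lam)
          (GKTensor.lie (AutomorphyDatum.gl n K hcpt).arch π.lieRepW (σ𝔤S hcpt lam) (toLie n K hcpt Xm)
            (@id (π.W ⊗[ℂ] ResGLnCohomology.CoeffModule ℂ n K lam) (η fun i => toLie n K hcpt (Y i))))
          (adelicPt hcpt (GLn.archOfMatrix n K m₀) c)) := by
  have h := (stub_fderiv_twistedEval hcpt π S lam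
    (@id (π.W ⊗[ℂ] ResGLnCohomology.CoeffModule ℂ n K lam) (η fun i => toLie n K hcpt (Y i))) c hm₀).2
    (toLie n K hcpt Xm)
  refine Eq.trans ?_ h
  -- evaluation at the fixed vectors `Y` commutes with `fderiv`
  have happ := fderiv_continuousAlternatingMap_apply_apply (g := fun i (_ : Matrix (Fin n) (Fin n) (mixedSpace K)) => Y i)
    (differentiableAt_leftForm π S lam η c hm₀) (fun _ => differentiableAt_const _) (m₀ * Xm)
  have hzero : ∀ i : Fin (q + 1), leftFormN π S lam η c m₀
      (Function.update (fun j => Y j) i (fderiv ℝ (fun _ : Matrix (Fin n) (Fin n) (mixedSpace K) => Y i) m₀ (m₀ * Xm))) = 0 := by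
    intro i
    rw [fderiv_fun_const, Pi.zero_apply, zero_apply]
    exact (leftFormN π S lam η c m₀).map_update_zero _ i
  simp only [hzero, Finset.sum_const_zero, add_zero] at happ
  exact happ.symm

/-! ### `dω̃ = 0` on the invertible matrices for a cocycle -/

/-- `toLie` is compatible with commutators: `toLie (A B - B A) = ⁅toLie A, toLie B⁆`. [folklore] -/
theorem toLie_commutator (A B : Matrix (Fin n) (Fin n) (mixedSpace K)) :
    toLie n K hcpt (A * B - B * A) = ⁅toLie n K hcpt A, toLie n K hcpt B⁆ :=
  Subtype.ext (by rw [LieSubalgebra.coe_bracket, coe_toLie, coe_toLie, coe_toLie, Ring.lie_def])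

set_option maxHeartbeats 800000 in
-- the closed CE formula is instantiated at the carrier of the complex (abbrev towers over the datum)
/-- **The left-trivialised form of a COCYCLE is closed on the invertible matrices**:
`dω̃(m₀)(m₀X₀, …, m₀X_{q+1}) = E(m₀) · (dη)(X₀, …, X_{q+1})(m₀, c) = 0` — the Maurer–Cartan identity
(`stub_extDeriv_leftTrivialised`), the derivative identification `fderiv_leftForm_apply`, and the closed
Chevalley–Eilenberg formula (`stub_ce_d_succ_apply_eq_sum`); every tuple is of the form `(m₀Xᵢ)ᵢ`.
[cite: BorelWallach2000, VII 2.2–2.5] -/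
theorem extDeriv_leftTrivForm_eq_zero {η : ConeDictionary.Cochain π lam (q + 1)}
    (hη : η ∈ (gkComplexLS π S lam).cocycles (q + 1)) (c : BigHeckeGLn.FiniteAdelicGL n K)
    {m₀ : Matrix (Fin n) (Fin n) (mixedSpace K)} (hm₀ : IsUnit m₀) :
    extDeriv (leftTrivFormN π S lam η c) m₀ = 0 := by
  have hd : Literature.Algebra.Lie.ChevalleyEilenberg.d ℝ _ _ (q + 1) η = 0 :=
    (((gkComplexLS π S lam).mem_cocycles_iff (q + 1) η).1 hη).2
  obtain ⟨g, rfl⟩ := hm₀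
  ext Y
  -- every tuple is `(g Xᵢ)ᵢ`
  set X : Fin (q + 2) → Matrix (Fin n) (Fin n) (mixedSpace K) :=
    fun i => ((g⁻¹ : (Matrix (Fin n) (Fin n) (mixedSpace K))ˣ) : Matrix (Fin n) (Fin n) (mixedSpace K)) * Y i with hX
  have hY : Y = fun i => (g : Matrix (Fin n) (Fin n) (mixedSpace K)) * X i := by
    funext i
    rw [hX, Units.mul_inv_cancel_left]
  rw [hY, ContinuousAlternatingMap.coe_zero, Pi.zero_apply,
    stub_extDeriv_leftTrivialised (leftFormN π S lam η c) g (differentiableAt_leftForm π S lam η c (Units.isUnit g)) X]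
  -- the derivative terms and the bracket terms are the two halves of `E(g) · (dη)(toLie ∘ X)(g, c)`
  have hkey : twistedEval π S lam (GLn.archOfMatrix n K (g : Matrix (Fin n) (Fin n) (mixedSpace K))) c
      (Literature.Algebra.Lie.ChevalleyEilenberg.d ℝ _ _ (q + 1) η (fun i => toLie n K hcpt (X i))) =
      (∑ i : Fin (q + 2), ((-1 : ℝ) ^ (i : ℕ)) •
          (fderiv ℝ (leftFormN π S lam η c) (g : Matrix (Fin n) (Fin n) (mixedSpace K))
            ((g : Matrix (Fin n) (Fin n) (mixedSpace K)) * X i)) (fun j => X (i.succAbove j))) +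
        ∑ i : Fin (q + 2), ∑ j : Fin (q + 1),
          if (i : ℕ) < ((i.succAbove j : Fin (q + 2)) : ℕ) then
            ((-1 : ℝ) ^ ((i : ℕ) + ((i.succAbove j : Fin (q + 2)) : ℕ))) •
              (leftFormN π S lam η c (g : Matrix (Fin n) (Fin n) (mixedSpace K)))
                (Fin.cons (X i * X (i.succAbove j) - X (i.succAbove j) * X i)
                  (fun l => X (i.succAbove (j.succAbove l))))
          else 0 := by
    rw [stub_ce_d_succ_apply_eq_sum (q) η (fun i => toLie n K hcpt (X i)), map_add, map_sum, map_sum]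
    congr 1
    · refine Finset.sum_congr rfl fun i _ => ?_
      rw [map_smul, fderiv_leftForm_apply π S lam η c (Units.isUnit g) (X i), twistedEval_apply]
      rfl
    · refine Finset.sum_congr rfl fun i _ => ?_
      rw [map_sum]
      refine Finset.sum_congr rfl fun j _ => ?_
      split_ifs with hij
      · rw [map_smul]
        change _ = _ • leftFormAlg π S lam η c (GLn.archOfMatrix n K (g : Matrix (Fin n) (Fin n) (mixedSpace K))) _
        rw [leftFormAlg_apply]
        have hfun : (Fin.cons ⁅toLie n K hcpt (X i), toLie n K hcpt (X (i.succAbove j))⁆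
              (fun l : Fin q => toLie n K hcpt (X (i.succAbove (j.succAbove l)))) :
                Fin (q + 1) → (AutomorphyDatum.gl n K hcpt).arch.lie) =
            fun k => toLie n K hcpt ((Fin.cons (X i * X (i.succAbove j) - X (i.succAbove j) * X i)
              (fun l : Fin q => X (i.succAbove (j.succAbove l))) :
                Fin (q + 1) → Matrix (Fin n) (Fin n) (mixedSpace K)) k) := by
          funext k
          refine Fin.cases ?_ (fun l => ?_) k
          · rw [Fin.cons_zero, Fin.cons_zero, toLie_commutator]
          · rw [Fin.cons_succ, Fin.cons_succ]
        rw [hfun]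
      · rw [map_zero]
  rw [← hkey, hd, AlternatingMap.zero_apply, map_zero]

/-! ### The left-trivialised form is differentiable at the invertible matrices -/

/-- `m ↦ (Y ↦ m⁻¹ Y)` is differentiable at the invertible matrices. [folklore] -/
theorem differentiableAt_mul_inverse {m₀ : Matrix (Fin n) (Fin n) (mixedSpace K)} (hm₀ : IsUnit m₀) :
    DifferentiableAt ℝ (fun m : Matrix (Fin n) (Fin n) (mixedSpace K) =>
      ContinuousLinearMap.mul ℝ (Matrix (Fin n) (Fin n) (mixedSpace K)) (Ring.inverse m)) m₀ := by
  exact (ContinuousLinearMap.mul ℝ (Matrix (Fin n) (Fin n) (mixedSpace K))).differentiableAt.comp _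
    (differentiableAt_inverse hm₀)

/-- **The left-trivialised form is differentiable at every invertible matrix.** [folklore] -/
theorem differentiableAt_leftTrivFormN (η : ConeDictionary.Cochain π lam (q + 1)) (c : BigHeckeGLn.FiniteAdelicGL n K)
    {m₀ : Matrix (Fin n) (Fin n) (mixedSpace K)} (hm₀ : IsUnit m₀) :
    DifferentiableAt ℝ (leftTrivFormN π S lam η c) m₀ :=
  (differentiableAt_leftForm π S lam η c hm₀).continuousAlternatingMapCompContinuousLinearMap
    (differentiableAt_mul_inverse hm₀)

/-! ### The cone form is differentiable and closed on the positive cone -/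

/-- A point of the positive cone is `g gᴴ` for an invertible matrix `g` (transitivity, `stub_coneModel`).
[cite: Borel1969, §12] -/
theorem exists_isUnit_mul_conjTranspose_eq_of_mem_posCone {H : ResGLnCone.hermSpace n K}
    (hH : H ∈ ResGLnCone.posCone n K) :
    ∃ g : Matrix (Fin n) (Fin n) (mixedSpace K), IsUnit g ∧ g * gᴴ = (H : Matrix (Fin n) (Fin n) (mixedSpace K)) := by
  obtain ⟨g, hg⟩ := (stub_coneModel n K).1 (H : Matrix (Fin n) (Fin n) (mixedSpace K)) hH.1 hH.2
  exact ⟨g, Units.isUnit g, hg⟩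

/-- The inclusion of the hermitian space in the matrices, as a continuous linear map. [folklore] -/
abbrev hermIncl : ResGLnCone.hermSpace n K →L[ℝ] Matrix (Fin n) (Fin n) (mixedSpace K) :=
  LinearMap.toContinuousLinearMap (ResGLnCone.hermSpace n K).subtype

/-- The conjugate transpose on `M_n(K_∞)` as a continuous `ℝ`-linear map. [folklore] -/
abbrev conjTransposeL : Matrix (Fin n) (Fin n) (mixedSpace K) →L[ℝ] Matrix (Fin n) (Fin n) (mixedSpace K) :=
  LinearMap.toContinuousLinearMap
    { toFun := fun A => Aᴴ
      map_add' := fun A B => Matrix.conjTranspose_add A B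
      map_smul' := fun r A => by rw [Matrix.conjTranspose_smul, star_trivial]; rfl }

set_option maxHeartbeats 800000 in
-- local sections, three eventual identities and the pullback computation in one declaration
/-- **The cone form is, near every point of the positive cone, the pullback of the left-trivialised form
along a smooth local section of the hermitian square.**  At `H₀ = g₀ g₀ᴴ` take the section `s` of
`stub_hermSquare_localSection` (`s H₀ = g₀`, `s(H) s(H)ᴴ = H`, `s H` invertible, `s` smooth near `H₀`);
for `H` near `H₀` both `ds(H) v` and `halfRight (s H) v` are right inverses of the differential
`Y ↦ Y s(H)ᴴ + s(H) Yᴴ` (the first by differentiating `s(H) s(H)ᴴ = H`), so by the pullback identity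
`ConeDictionary.coneForm_apply_tangent` the cone form at `H` is `ω̃(s H) ∘ ∧ ds(H)`.
[cite: BorelWallach2000, VII 2.2–2.4] -/
theorem coneForm_eventuallyEq_pullback {η : ConeDictionary.Cochain π lam (q + 1)}
    (hη : η ∈ (gkComplexLS π S lam).carrier (q + 1)) (c : BigHeckeGLn.FiniteAdelicGL n K)
    {H₀ : ResGLnCone.hermSpace n K} (hH₀ : H₀ ∈ ResGLnCone.posCone n K) :
    ∃ s : ResGLnCone.hermSpace n K → Matrix (Fin n) (Fin n) (mixedSpace K),
      IsUnit (s H₀) ∧ ContDiffAt ℝ ∞ s H₀ ∧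
        (fun H => (leftTrivFormN π S lam η c (s H)).compContinuousLinearMap (fderiv ℝ s H)) =ᶠ[𝓝 H₀]
          fun H => coneForm π S lam η c H := by
  obtain ⟨g₀, hg₀u, hg₀⟩ := exists_isUnit_mul_conjTranspose_eq_of_mem_posCone hH₀
  obtain ⟨s, hs₀, hsmooth, hsq, hunit⟩ := stub_hermSquare_localSection n K g₀ hg₀u H₀ hg₀.symm
  refine ⟨s, hs₀ ▸ hg₀u, ?_, ?_⟩
  · exact hsmooth.self_of_nhds
  -- on a neighbourhood: `s` differentiable, `s sᴴ = id` eventually, `s` invertible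
  have hsq' := hsq.eventually_nhds
  filter_upwards [hsmooth, hsq', hunit] with H hsm hsqH huH
  have hdiff : DifferentiableAt ℝ s H := hsm.differentiableAt (by simp)
  -- differentiate `s(H) s(H)ᴴ = H` at `H`: `ds v · sᴴ + s · (ds v)ᴴ = v`
  have hF : HasFDerivAt (fun H' : ResGLnCone.hermSpace n K => s H' * (s H')ᴴ)
      (s H • (conjTransposeL.comp (fderiv ℝ s H)) + MulOpposite.op ((s H)ᴴ) • fderiv ℝ s H) H := by
    have h1 : HasFDerivAt s (fderiv ℝ s H) H := hdiff.hasFDerivAt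
    have h2 : HasFDerivAt (fun H' => (s H')ᴴ) (conjTransposeL.comp (fderiv ℝ s H)) H :=
      (conjTransposeL (n := n) (K := K)).hasFDerivAt.comp H h1
    exact h1.mul' h2
  have hid : HasFDerivAt (fun H' : ResGLnCone.hermSpace n K => (H' : Matrix (Fin n) (Fin n) (mixedSpace K)))
      (hermIncl (n := n) (K := K)) H := (hermIncl (n := n) (K := K)).hasFDerivAt
  have hderiv : s H • (conjTransposeL.comp (fderiv ℝ s H)) + MulOpposite.op ((s H)ᴴ) • fderiv ℝ s H =
      hermIncl (n := n) (K := K) :=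
    (hF.congr_of_eventuallyEq (hsqH.mono fun H' h => h.symm)).unique hid
  have hv : ∀ w : ResGLnCone.hermSpace n K, (w : Matrix (Fin n) (Fin n) (mixedSpace K)) =
      fderiv ℝ s H w * (s H)ᴴ + s H * (fderiv ℝ s H w)ᴴ := by
    intro w
    have h := congrArg (fun L : ResGLnCone.hermSpace n K →L[ℝ] Matrix (Fin n) (Fin n) (mixedSpace K) => L w) hderiv
    change s H * (fderiv ℝ s H w)ᴴ + fderiv ℝ s H w * (s H)ᴴ = (w : Matrix (Fin n) (Fin n) (mixedSpace K)) at h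
    rw [← h, add_comm]
  -- the matrix of `archOfMatrix (s H)` is `s H`
  have hcoe : (((GLn.archOfMatrix n K (s H) : (AutomorphyDatum.gl n K hcpt).arch.carrier) :
      GL (Fin n) (mixedSpace K)) : Matrix (Fin n) (Fin n) (mixedSpace K)) = s H := GLn.coe_archOfMatrix huH
  have hsqH₀ : s H * (s H)ᴴ = (H : Matrix (Fin n) (Fin n) (mixedSpace K)) := hsqH.self_of_nhds
  ext v
  rw [ContinuousAlternatingMap.compContinuousLinearMap_apply]
  have key := coneForm_apply_tangent π S lam hη c (GLn.archOfMatrix n K (s H)) (H := H)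
    (by rw [hcoe]; exact hsqH₀) (fun i => fderiv ℝ s H (v i)) v (fun i => by rw [hcoe]; exact hv (v i))
  rw [hcoe] at key
  exact key.symm

/-- **The cone form of a cochain of the complex is differentiable at every point of the positive cone.**
[cite: BorelWallach2000, VII 2.2–2.4] -/
theorem differentiableAt_coneForm {η : ConeDictionary.Cochain π lam (q + 1)}
    (hη : η ∈ (gkComplexLS π S lam).carrier (q + 1)) (c : BigHeckeGLn.FiniteAdelicGL n K)
    {H₀ : ResGLnCone.hermSpace n K} (hH₀ : H₀ ∈ ResGLnCone.posCone n K) :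
    DifferentiableAt ℝ (fun H => coneForm π S lam η c H) H₀ := by
  obtain ⟨s, hsu, hsmooth, heq⟩ := coneForm_eventuallyEq_pullback π S lam hη c hH₀
  have h1 : DifferentiableAt ℝ (fun H => leftTrivFormN π S lam η c (s H)) H₀ :=
    (differentiableAt_leftTrivFormN π S lam η c hsu).comp H₀ (hsmooth.differentiableAt (by simp))
  have hinf : (∞ : WithTop ℕ∞) + 1 ≤ ∞ := by simp
  have h2 := (hsmooth.fderiv_right hinf).differentiableAt (by simp)
  have hd := h1.continuousAlternatingMapCompContinuousLinearMap h2
  exact (heq.differentiableAt_iff).1 hd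

/-- **The cone form of a COCYCLE is closed on the positive cone**: `dω = s^*(dω̃) = 0`.
[cite: BorelWallach2000, VII 2.2–2.5] -/
theorem extDeriv_coneForm_eq_zero {η : ConeDictionary.Cochain π lam (q + 1)}
    (hη : η ∈ (gkComplexLS π S lam).cocycles (q + 1)) (c : BigHeckeGLn.FiniteAdelicGL n K)
    {H₀ : ResGLnCone.hermSpace n K} (hH₀ : H₀ ∈ ResGLnCone.posCone n K) :
    extDeriv (fun H => coneForm π S lam η c H) H₀ = 0 := by
  have hmem : η ∈ (gkComplexLS π S lam).carrier (q + 1) :=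
    (((gkComplexLS π S lam).mem_cocycles_iff (q + 1) η).1 hη).1
  obtain ⟨s, hsu, hsmooth, heq⟩ := coneForm_eventuallyEq_pullback π S lam hmem c hH₀
  have h0 : extDeriv (fun H => (leftTrivFormN π S lam η c (s H)).compContinuousLinearMap (fderiv ℝ s H)) H₀ = 0 := by
    rw [extDeriv_pullback (differentiableAt_leftTrivFormN π S lam η c hsu) hsmooth
        (by rw [minSmoothness_of_isRCLikeNormedField]; exact WithTop.coe_le_coe.2 le_top),
      extDeriv_leftTrivForm_eq_zero π S lam hη c hsu]
    ext v
    rfl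
  exact heq.extDeriv_eq.symm.trans h0

/-! ### (b1) The cone form of a level-fixed cocycle is an equivariant family of closed forms -/

open ResGLnCohomology BigHeckeGLn in
/-- **Stub (b1) of line `Sketch` — `TwistedQuotient.IsConeFormFamily` for the cone form of a
level-fixed COCYCLE** (registered signature): the positive cone is open, convex and `GL_n(K)⁺`-stable
(tree), `E_λ(γ)` is continuous (finite dimension), `ω(c)` is differentiable with `dω(c) = 0` on the
cone (`differentiableAt_coneForm`, `extDeriv_coneForm_eq_zero`), `ω(c u) = ω(c)` on the level
(`ConeDictionary.coneForm_mul_of_isLevelFixed`), and the `GL_n(K)⁺`-equivariance is the hypothesis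
`hequiv` (stub (b2), `stub_coneForm_equivariant`). [cite: BorelWallach2000, VII 2.2–2.5]
[cite: Borel1983Regularization, §3] [cite: Dupont1976, §1–2] -/
theorem stub_coneForm_isConeFormFamily {n : ℕ} {K : Type} [Field K] [NumberField K]
    (hcpt : isCompact_glFiniteIntegralLevel n K) (𝔫 : Ideal (𝓞 K))
    (π : AutomorphicRepData (AutomorphyDatum.gl n K hcpt))
    (S : Finset {w : InfinitePlace K // w.IsReal}) (lam : (K →+* ℂ) → Fin n → ℤ) {q : ℕ}
    {η : ConeDictionary.Cochain π lam (q + 1)}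
    (hη : η ∈ (ConeDictionary.gkComplexLS π S lam).cocycles (q + 1))
    (hfix : ConeDictionary.IsLevelFixed π lam 𝔫 η)
    (hequiv : ∀ (γ : glTotPos n K) (c : FiniteAdelicGL n K) (H : ResGLnCone.hermSpace n K),
      H ∈ ResGLnCone.posCone n K → ∀ v : Fin (q + 1) → ResGLnCone.hermSpace n K,
        ConeDictionary.coneForm π S lam η (diagPos n K γ * c)
            (ResGLnCone.coneActionRat n K (γ : GL (Fin n) K) H)
            (fun j => ResGLnCone.coneActionRat n K (γ : GL (Fin n) K) (v j)) =
          coeffRepPos ℂ n K lam γ (ConeDictionary.coneForm π S lam η c H v)) :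
    TwistedQuotient.IsConeFormFamily (diagPos n K) (level n K 𝔫) (coeffRepPos ℂ n K lam)
      ((ResGLnCone.coneActionRat n K).comp (glTotPos n K).subtype) (ResGLnCone.posCone n K)
      (fun c H => ConeDictionary.coneForm π S lam η c H) := by
  have hmem : η ∈ (gkComplexLS π S lam).carrier (q + 1) :=
    (((gkComplexLS π S lam).mem_cocycles_iff (q + 1) η).1 hη).1
  haveI : FiniteDimensional ℂ (ResGLnCohomology.CoeffModule ℂ n K lam) :=
    ResGLnCohomology.finiteDimensional_coeffModule n K lam
  exact
    { isOpen := ResGLnCone.isOpen_posCone n K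
      convex := ResGLnCone.convex_posCone n K
      mapsTo := fun γ => ResGLnCone.mapsTo_coneActionRat_posCone n K (γ : GL (Fin n) K)
      continuous_ρ := fun γ =>
        LinearMap.continuous_of_finiteDimensional (ResGLnCohomology.coeffRepPos ℂ n K lam γ)
      differentiableOn := fun c H hH => (differentiableAt_coneForm π S lam hmem c hH).differentiableWithinAt
      extDeriv_eq_zero := fun c H hH => extDeriv_coneForm_eq_zero π S lam hη c hH
      mul_mem := fun c u hu => coneForm_mul_of_isLevelFixed π S lam hfix c hu
      equivariant := fun γ c H hH v => hequiv γ c H hH v }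

end Summit.Langlands.Langlands.Theorems.HeckeEigenvalueField.Res

end
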